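import Summits.AtomisticToContinuum.HydrodynamicLimit.Theorems.CollisionIsometryCLTAdaptedWeightCLTSAScaleSplit
import Summits.AtomisticToContinuum.HydrodynamicLimit.Theorems.CollisionIsometryCLTAdaptedWeightCLTSACellUI
import Summits.AtomisticToContinuum.HydrodynamicLimit.Theorems.CollisionIsometryCLTAdaptedWeightCLTSAWindowOfUI
import Summits.AtomisticToContinuum.HydrodynamicLimit.Theorems.CollisionIsometryCLTAdaptedWeightCLTSASuperExpInvariance
import Summits.AtomisticToContinuum.HydrodynamicLimit.Theorems.CollisionIsometryCLTAdaptedWeightCLTSASuperExpScales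
import Summits.AtomisticToContinuum.HydrodynamicLimit.Theorems.CollisionIsometryCLTDiffuseBackwardInfluenceEntropyTransfer

/-!
# Line `sustained-anisotropy-superexp` for the crux `AdaptedWeightCLT`: the COMPOSITION CERTIFICATE
(stmt-AtomisticToContinuum-14868, rev-12 TIME-LOCAL form; route `CollisionIsometryCLT`, sub-problem `HydrodynamicLimit`;
line lead `prover-line-stmt-AtomisticToContinuum-14868-a1-0`; `--supports` — a CONDITIONAL result, it closes nothing by itself)

This sorry-free file records in the tree what the line has reduced the crux to. With the landed stubs
`stub_scaleSplit` (`…SAScaleSplit`, p142436), `stub_cellUI` (`…SACellUI`, p142444), `stub_windowOfUI` (`…SAWindowOfUI`, p144975),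
the landed reductions of `stub_superExp` (`SuperExp.superExpStub_of_core`, `…SASuperExpScales`, p140682; `superExp_invariance_anchor`,
`…SASuperExpInvariance`, p140420) and the landed entropy-budget domination `EntropyTransfer.exists_localGibbsLaw_le_exp_mul_eqLaw`,
the crux `CollisionIsometryCLT.AdaptedWeightCLT` follows BY NAME from exactly two named residues:

* `ReynoldsStub` (vocabulary A; the line's DECLARED EXPOSURE — the sub-block Reynolds remainder vanishes in probability along the evolved
  law for every `t > 0`; MesoQuiescence-class; its equilibrium rung `stub_reynolds_const` is landed in `…SAReynoldsDynamics`, p144835), and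
* `SuperExpCoreRateStub` (below) — the equilibrium large deviation of window-sustained cell anisotropy for the canonical cell kernel and
  kinetic window AT A PRESCRIBED RATE: `∀ θe > 0, ∀ c > 0, ∃ σ₁ > 0, ∀ σ < σ₁, ∀ admissible φ, SuperExp.SuperExpCoreAtRate θe c σ φ`. This is
  the line's open dynamical core in its WEAKEST sufficient form (lead's reshape v5): the composition only ever transfers at the single rate
  `c = Cd + 1`, `Cd` = the entropy-budget constant of the profiles, which is known BEFORE `σ₀` is chosen — so the rate may be fixed first and
  `σ₁`, `ε` may depend on it. The planner's `∀ c`-form (`SuperExpCoreStub`, i.e. `SuperExp.SuperExpCore`) implies it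
  (`superExpCoreRateStub_of_coreStub`).

`adaptedWeightCLT_of_residues : ReynoldsStub → SuperExpCoreRateStub → …Theses.CollisionIsometryCLT.AdaptedWeightCLT` (registered anchor
`sa_composition_anchor`). Contents: `transfer_uniform` / `transfer_rate` (smallness under `G_N` at rate `Cd + 1`, uniformly in the window
end, becomes smallness under the local Gibbs law via `P_N ≤ e^{Cd(N+1)} G_N`), `windowStub_holds`, `scaleSplitStub_holds`,
`superExpStub_of_coreStub`, `superExpRateStub_of_coreRateStub`, `AdaptedWeightCLT_of` (the planner's four-stub composition),
`AdaptedWeightCLT_of_rate` (the same at a prescribed rate), `adaptedWeightCLT_of_residues`.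
-/

namespace Summit.AtomisticToContinuum.HydrodynamicLimit.Theorems.SustainedAnisotropy

open scoped BigOperators Topology Classical MeasureTheory ENNReal InnerProductSpace
open Filter Set MeasureTheory
open Literature.Analysis.FluidPDE
open Summit.AtomisticToContinuum.HydrodynamicLimit.Theorems.ContactSourceDuhamel
open Summit.AtomisticToContinuum.HydrodynamicLimit.Theorems.ContactSourceDuhamel.TimeLocal
open Summit.AtomisticToContinuum.HydrodynamicLimit.Theorems.ContactBalance
open Summit.AtomisticToContinuum.HydrodynamicLimit.Theorems.DiffuseBackwardInfluenceShare (eqLaw)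
open Summit.AtomisticToContinuum.HydrodynamicLimit.Theorems.DiffuseBackwardInfluenceShare.EntropyTransfer
  (exists_localGibbsLaw_le_exp_mul_eqLaw eventually_exp_mul_le)
open Literature.MathematicalPhysics.KineticTheory (hsDiameter localGibbsLaw)

noncomputable section

/-! ## The open core as a named statement -/

/-- The line's OPEN CORE as a closed proposition: for every reference temperature `θe > 0` there is `σ₁ > 0` such that for all
`0 < σ < σ₁` and every admissible block kernel family the equilibrium super-exponential bound `SuperExp.SuperExpCore θe σ φ` holds
(canonical cell kernel `SuperExp.cellKer` and kinetic window `SuperExp.kinWin`, window START). Taken as a HYPOTHESIS below (it was the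
stub `stub_superExpCore` of skeleton v3/v4; skeleton v5 registers the weaker prescribed-rate form `stub_superExpCoreRate`). -/
def SuperExpCoreStub : Prop := ∀ θe : ℝ, 0 < θe → ∃ σ₁ : ℝ, 0 < σ₁ ∧ ∀ σ : ℝ, 0 < σ → σ < σ₁ →
  ∀ (γ C : ℝ) (φ : ℕ → T3 → ℝ), 0 < γ → γ ≤ 1 / 15 → AdmissibleKernel γ C φ → SuperExp.SuperExpCore θe σ φ

/-- `SuperExpStub` (the planner's stub 3, with its `∃ σ₁`, `∃ (ψ, ℓ, Δ)` and `∀ t' ≥ Δ_N`) from the core: the canonical scales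
(`SuperExp.superExpStub_of_core`) and uniformity in the window end under the invariant `G_N` (`superExp_invariance_anchor`). -/
theorem superExpStub_of_coreStub (hcore : SuperExpCoreStub) : SuperExpStub :=
  SuperExp.superExpStub_of_core superExp_invariance_anchor hcore

/-- The core AT A PRESCRIBED RATE `c` (reference temperature `θe`, reduced diameter `σ`, block kernel family `φ`): for the canonical
cell kernel `SuperExp.cellKer` and kinetic window `SuperExp.kinWin`, every flow family and every `a, λ, Cw > 0` there is `ε > 0` with,
eventually in `N`, `G_N(susEvent at the window START) ≤ e^{−c(N+1)}`. (`SuperExp.SuperExpCore θe σ φ` is `∀ c` of this with `ε`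
chosen before `c`.) -/
def SuperExp.SuperExpCoreAtRate (θe c σ : ℝ) (φ : ℕ → T3 → ℝ) : Prop :=
  ∀ (Φ : Flows σ) (a lam Cw : ℝ), 0 < a → 0 < lam → 0 < Cw → ∃ ε : ℝ, 0 < ε ∧
    ∀ᶠ N : ℕ in atTop,
      localGibbsLaw σ (fun _ => 1) (fun _ => 0) (fun _ => θe) N (Φ N)
          (susEvent σ N (Φ N) φ SuperExp.cellKer (SuperExp.kinWin N) a ε lam Cw (SuperExp.kinWin N)) ≤
        ENNReal.ofReal (Real.exp (-(c * ((N : ℝ) + 1))))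

/-- The line's open core in its WEAKEST SUFFICIENT form (reshape v5): the rate `c` is prescribed FIRST, then `σ₁` (and, inside, `ε`) may
depend on it. Registered stub `stub_superExpCoreRate` of the skeleton. -/
def SuperExpCoreRateStub : Prop := ∀ θe : ℝ, 0 < θe → ∀ c : ℝ, 0 < c → ∃ σ₁ : ℝ, 0 < σ₁ ∧ ∀ σ : ℝ, 0 < σ → σ < σ₁ →
  ∀ (γ C : ℝ) (φ : ℕ → T3 → ℝ), 0 < γ → γ ≤ 1 / 15 → AdmissibleKernel γ C φ → SuperExp.SuperExpCoreAtRate θe c σ φ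

/-- The planner's `∀ c`-form of the core implies the prescribed-rate form. -/
theorem superExpCoreRateStub_of_coreStub (h : SuperExpCoreStub) : SuperExpCoreRateStub := by
  intro θe hθe c hc
  obtain ⟨σ₁, hσ₁, H⟩ := h θe hθe
  refine ⟨σ₁, hσ₁, fun σ hσ hσ' γ C φ hγ hγ' hadm Φ a lam Cw ha hlam hCw => ?_⟩
  obtain ⟨ε, hε, Hc⟩ := H σ hσ hσ' γ C φ hγ hγ' hadm Φ a lam Cw ha hlam hCw
  exact ⟨ε, hε, Hc c hc⟩

/-- Stub 3 AT A PRESCRIBED RATE: `∀ θe > 0, ∀ c > 0, ∃ σ₁ > 0, ∀ σ < σ₁, ∀ admissible φ, ∃ (ψ, ℓ, Δ)` (cell kernel, window) with the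
`G_N`-bound `e^{−c(N+1)}` for all window ends `t' ≥ Δ_N` (the scale binders of `SuperExpStub` are dropped: the composition discards them,
and the canonical scales have them anyway, `SuperExp.tendsto_scale_viscous/decoupling`). -/
def SuperExpRateStub : Prop := ∀ θe : ℝ, 0 < θe → ∀ c : ℝ, 0 < c → ∃ σ₁ : ℝ, 0 < σ₁ ∧ ∀ σ : ℝ, 0 < σ → σ < σ₁ →
  ∀ (γ C : ℝ) (φ : ℕ → T3 → ℝ), 0 < γ → γ ≤ 1 / 15 → AdmissibleKernel γ C φ →
    ∃ (ψ : ℕ → T3 → ℝ) (ℓ Δ : ℕ → ℝ), CellKernel ψ ℓ ∧ Window Δ ∧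
      ∀ (Φ : Flows σ) (a lam Cw : ℝ), 0 < a → 0 < lam → 0 < Cw → ∃ ε : ℝ, 0 < ε ∧
        ∀ᶠ N : ℕ in atTop, ∀ t' : ℝ, Δ N ≤ t' →
          localGibbsLaw σ (fun _ => 1) (fun _ => 0) (fun _ => θe) N (Φ N) (susEvent σ N (Φ N) φ ψ (Δ N) a ε lam Cw t') ≤
            ENNReal.ofReal (Real.exp (-(c * ((N : ℝ) + 1))))

/-- The prescribed-rate stub 3 from the prescribed-rate core: canonical scales (`SuperExp.cellKernel_cellKer`, `SuperExp.window_kinWin`)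
and uniformity in the window end under the invariant `G_N` (`superExp_invariance_anchor`). -/
theorem superExpRateStub_of_coreRateStub (h : SuperExpCoreRateStub) : SuperExpRateStub := by
  intro θe hθe c hc
  obtain ⟨σ₁, hσ₁, H⟩ := h θe hθe c hc
  refine ⟨σ₁, hσ₁, fun σ hσ hσ' γ C φ hγ hγ' hadm => ?_⟩
  refine ⟨SuperExp.cellKer, SuperExp.cellRad, SuperExp.kinWin, SuperExp.cellKernel_cellKer, SuperExp.window_kinWin,
    fun Φ a lam Cw ha hlam hCw => ?_⟩
  obtain ⟨ε, hε, Hc⟩ := H σ hσ hσ' γ C φ hγ hγ' hadm Φ a lam Cw ha hlam hCw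
  refine ⟨ε, hε, ?_⟩
  filter_upwards [Hc] with N hN t' _
  exact (superExp_invariance_anchor σ θe N (Φ N) φ SuperExp.cellKer (SuperExp.kinWin N) a ε lam Cw t').trans hN

/-- `WindowStub` (the planner's stub 4) HOLDS: glue of the landed `stub_cellUI` and `stub_windowOfUI`. -/
theorem windowStub_holds : WindowStub := windowStub_of stub_cellUI stub_windowOfUI

/-- `ScaleSplitStub` (the planner's stub 1) HOLDS: the landed `stub_scaleSplit`. -/
theorem scaleSplitStub_holds : ScaleSplitStub := stub_scaleSplit

/-! ## The transfer and the composition -/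

/-- THE TRANSFER (proved, no stub): a family of events that is super-exponentially rare under the homogeneous Gibbs law
`G_N = localGibbsLaw σ 1 0 θe` for EVERY rate `c` — uniformly over a parameter `t'` — is negligible under the local Gibbs law,
uniformly in `t'`, as soon as `P_N ≤ e^{C(N+1)} G_N` on every set (the measure form of the `O(N)` entropy budget, landed as
`EntropyTransfer.exists_localGibbsLaw_le_exp_mul_eqLaw`): take `c = C + 1`. -/
theorem transfer_uniform {σ θe Cd : ℝ} {a₀ θ₀ : T3 → ℝ} {u₀ : T3 → V3} {Φ : Flows σ}
    (hdom : ∀ (N : ℕ) (A : Set (Cfg N)), localGibbsLaw σ a₀ u₀ θ₀ N (Φ N) A ≤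
      ENNReal.ofReal (Real.exp (Cd * ((N : ℝ) + 1))) * eqLaw σ θe N (Φ N) A)
    {E : (N : ℕ) → ℝ → Set (Cfg N)} {Δ : ℕ → ℝ}
    (hG : ∀ c : ℝ, 0 < c → ∀ᶠ N : ℕ in atTop, ∀ t' : ℝ, Δ N ≤ t' →
      localGibbsLaw σ (fun _ => 1) (fun _ => 0) (fun _ => θe) N (Φ N) (E N t') ≤
        ENNReal.ofReal (Real.exp (-(c * ((N : ℝ) + 1)))))
    (hCd : 0 ≤ Cd) {η : ℝ} (hη : 0 < η) :
    ∀ᶠ N : ℕ in atTop, ∀ t' : ℝ, Δ N ≤ t' → localGibbsLaw σ a₀ u₀ θ₀ N (Φ N) (E N t') ≤ ENNReal.ofReal η := by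
  have hCd1 : Cd < Cd + 1 := lt_add_one Cd
  filter_upwards [hG (Cd + 1) (by linarith), eventually_exp_mul_le hCd1 hη] with N hN hηN t' ht'
  calc localGibbsLaw σ a₀ u₀ θ₀ N (Φ N) (E N t')
      ≤ ENNReal.ofReal (Real.exp (Cd * ((N : ℝ) + 1))) * eqLaw σ θe N (Φ N) (E N t') := hdom N _
    _ ≤ ENNReal.ofReal (Real.exp (Cd * ((N : ℝ) + 1))) *
          ENNReal.ofReal (Real.exp (-((Cd + 1) * ((N : ℝ) + 1)))) :=
        mul_le_mul_right (show eqLaw σ θe N (Φ N) (E N t') ≤ _ from hN t' ht') _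
    _ = ENNReal.ofReal (Real.exp ((Cd - (Cd + 1)) * ((N : ℝ) + 1))) := by
        rw [← ENNReal.ofReal_mul (Real.exp_pos _).le, ← Real.exp_add]
        congr 2
        ring
    _ ≤ ENNReal.ofReal η := ENNReal.ofReal_le_ofReal hηN

/-- THE TRANSFER AT THE PRESCRIBED RATE `Cd + 1`: the same, asking the `G_N`-bound at the single rate `Cd + 1` only. -/
theorem transfer_rate {σ θe Cd : ℝ} {a₀ θ₀ : T3 → ℝ} {u₀ : T3 → V3} {Φ : Flows σ}
    (hdom : ∀ (N : ℕ) (A : Set (Cfg N)), localGibbsLaw σ a₀ u₀ θ₀ N (Φ N) A ≤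
      ENNReal.ofReal (Real.exp (Cd * ((N : ℝ) + 1))) * eqLaw σ θe N (Φ N) A)
    {E : (N : ℕ) → ℝ → Set (Cfg N)} {Δ : ℕ → ℝ}
    (hG : ∀ᶠ N : ℕ in atTop, ∀ t' : ℝ, Δ N ≤ t' →
      localGibbsLaw σ (fun _ => 1) (fun _ => 0) (fun _ => θe) N (Φ N) (E N t') ≤
        ENNReal.ofReal (Real.exp (-((Cd + 1) * ((N : ℝ) + 1)))))
    {η : ℝ} (hη : 0 < η) :
    ∀ᶠ N : ℕ in atTop, ∀ t' : ℝ, Δ N ≤ t' → localGibbsLaw σ a₀ u₀ θ₀ N (Φ N) (E N t') ≤ ENNReal.ofReal η := by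
  have hCd1 : Cd < Cd + 1 := lt_add_one Cd
  filter_upwards [hG, eventually_exp_mul_le hCd1 hη] with N hN hηN t' ht'
  calc localGibbsLaw σ a₀ u₀ θ₀ N (Φ N) (E N t')
      ≤ ENNReal.ofReal (Real.exp (Cd * ((N : ℝ) + 1))) * eqLaw σ θe N (Φ N) (E N t') := hdom N _
    _ ≤ ENNReal.ofReal (Real.exp (Cd * ((N : ℝ) + 1))) *
          ENNReal.ofReal (Real.exp (-((Cd + 1) * ((N : ℝ) + 1)))) :=
        mul_le_mul_right (show eqLaw σ θe N (Φ N) (E N t') ≤ _ from hN t' ht') _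
    _ = ENNReal.ofReal (Real.exp ((Cd - (Cd + 1)) * ((N : ℝ) + 1))) := by
        rw [← ENNReal.ofReal_mul (Real.exp_pos _).le, ← Real.exp_add]
        congr 2
        ring
    _ ≤ ENNReal.ofReal η := ENNReal.ofReal_le_ofReal hηN

/-- **THE COMPOSITION.** The four stubs give the crux `CollisionIsometryCLT.AdaptedWeightCLT` (rev-12, time-local form) BY NAME:
`adaptedWeightCLT_iff` (`Iff.rfl`); the reference temperature `θe` and budget `Cd` of the landed domination;
`σ₀ := min (σ₀(reynolds), σ₁(superExp), 1/2)`; per horizon `cruxTailT_of_conclOn` and `conclOn_of_tendsto_defect` (the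
crux's event IS `{δ < ∫₀ᵗ∫ₓ DefectSq}`); STUB 3 supplies the cell kernel, the window and the `G_N`-bound, `transfer_uniform`
moves it to `P_N`, STUB 4 (with H1, H2) turns it into `P{δ/K < CellInt} → 0`, STUB 2 gives `P{δ/K < ReynInt} → 0`, and
STUB 1 squeezes. -/
theorem AdaptedWeightCLT_of (h1 : ScaleSplitStub) (h2 : ReynoldsStub) (h3 : SuperExpStub) (h4 : WindowStub) :
    Summit.AtomisticToContinuum.HydrodynamicLimit.Theses.CollisionIsometryCLT.AdaptedWeightCLT := by
  rw [adaptedWeightCLT_iff]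
  intro a₀ θ₀ u₀ ha hθ hu ha0 hθ0
  have hnice : NiceProfiles a₀ θ₀ u₀ := ⟨ha, hθ, hu, ha0, hθ0⟩
  obtain ⟨θe, hθe, Cd, hCd0, hdom⟩ := exists_localGibbsLaw_le_exp_mul_eqLaw ha hθ hu ha0 hθ0
  obtain ⟨K, hK, H1⟩ := h1
  obtain ⟨σ₂, hσ₂, H2⟩ := h2 a₀ θ₀ u₀ hnice
  obtain ⟨σ₃, hσ₃, H3⟩ := h3 θe hθe
  refine ⟨min (min σ₂ σ₃) 2⁻¹, lt_min (lt_min hσ₂ hσ₃) (by norm_num), fun σ hσ hσlt Φ hDiff => ?_⟩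
  have hσ₂' : σ < σ₂ := lt_of_lt_of_le hσlt ((min_le_left _ _).trans (min_le_left _ _))
  have hσ₃' : σ < σ₃ := lt_of_lt_of_le hσlt ((min_le_left _ _).trans (min_le_right _ _))
  have hσ2 : σ < 2⁻¹ := lt_of_lt_of_le hσlt (min_le_right _ _)
  have hσhalf : σ ≤ 1 / 2 := by rw [one_div]; exact hσ2.le
  refine cruxTailT_of_conclOn fun t ht hT => ?_
  refine SourceContraction.conclOn_of_tendsto_defect fun γ C φ hγ hγ' hadm δ hδ => ?_
  -- STUB 3: the cell kernel, the kinetic window and the equilibrium bound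
  obtain ⟨ψ, ℓ, Δ, hcell, hwin, -, -, HLD⟩ := H3 σ hσ hσ₃' γ C φ hγ hγ' hadm
  -- transfer to the local Gibbs law, uniformly in the window end
  have hsmall : ∀ (a lam Cw : ℝ), 0 < a → 0 < lam → 0 < Cw → ∃ ε : ℝ, 0 < ε ∧ ∀ η : ℝ, 0 < η →
      ∀ᶠ N : ℕ in atTop, ∀ t' : ℝ, Δ N ≤ t' →
        localGibbsLaw σ a₀ u₀ θ₀ N (Φ N) (susEvent σ N (Φ N) φ ψ (Δ N) a ε lam Cw t') ≤ ENNReal.ofReal η := by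
    intro a lam Cw ha' hlam hCw
    obtain ⟨ε, hε, Hc⟩ := HLD Φ a lam Cw ha' hlam hCw
    exact ⟨ε, hε, fun η hη =>
      transfer_uniform (E := fun N t' => susEvent σ N (Φ N) φ ψ (Δ N) a ε lam Cw t')
        (fun N A => hdom σ hσhalf N (Φ N) A) Hc hCd0 hη⟩
  -- the three limits and the squeeze
  have hsplit := H1 σ hσ hσ2 a₀ θ₀ u₀ Φ γ C φ hγ hγ' hadm ψ ℓ hcell t ht δ hδ
  have hR := H2 σ hσ hσ₂' Φ hDiff γ C φ hγ hγ' hadm ψ ℓ hcell t ht hT (K⁻¹ * δ) (by positivity)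
  have hCell := h4 a₀ θ₀ u₀ hnice σ hσ hσ2 Φ hDiff γ C φ hγ hγ' hadm ψ ℓ hcell Δ hwin t ht hT hsmall
    (K⁻¹ * δ) (by positivity)
  have hsum := hCell.add hR
  rw [add_zero] at hsum
  exact tendsto_of_tendsto_of_tendsto_of_le_of_le' tendsto_const_nhds hsum
    (Eventually.of_forall fun N => bot_le) hsplit

/-- **THE COMPOSITION AT A PRESCRIBED RATE** (reshape v5). Same assembly, but stub 3 is asked only at the rate `Cd + 1`, where `Cd`
is the entropy-budget constant of the profiles (`EntropyTransfer.exists_localGibbsLaw_le_exp_mul_eqLaw`), obtained BEFORE `σ₀` is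
chosen: `σ₀ := min (σ₀(reynolds), σ₁(superExp at rate Cd + 1), 1/2)`. -/
theorem AdaptedWeightCLT_of_rate (h1 : ScaleSplitStub) (h2 : ReynoldsStub) (h3 : SuperExpRateStub) (h4 : WindowStub) :
    Summit.AtomisticToContinuum.HydrodynamicLimit.Theses.CollisionIsometryCLT.AdaptedWeightCLT := by
  rw [adaptedWeightCLT_iff]
  intro a₀ θ₀ u₀ ha hθ hu ha0 hθ0
  have hnice : NiceProfiles a₀ θ₀ u₀ := ⟨ha, hθ, hu, ha0, hθ0⟩
  obtain ⟨θe, hθe, Cd, hCd0, hdom⟩ := exists_localGibbsLaw_le_exp_mul_eqLaw ha hθ hu ha0 hθ0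
  obtain ⟨K, hK, H1⟩ := h1
  obtain ⟨σ₂, hσ₂, H2⟩ := h2 a₀ θ₀ u₀ hnice
  obtain ⟨σ₃, hσ₃, H3⟩ := h3 θe hθe (Cd + 1) (by linarith [hCd0])
  refine ⟨min (min σ₂ σ₃) 2⁻¹, lt_min (lt_min hσ₂ hσ₃) (by norm_num), fun σ hσ hσlt Φ hDiff => ?_⟩
  have hσ₂' : σ < σ₂ := lt_of_lt_of_le hσlt ((min_le_left _ _).trans (min_le_left _ _))
  have hσ₃' : σ < σ₃ := lt_of_lt_of_le hσlt ((min_le_left _ _).trans (min_le_right _ _))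
  have hσ2 : σ < 2⁻¹ := lt_of_lt_of_le hσlt (min_le_right _ _)
  have hσhalf : σ ≤ 1 / 2 := by rw [one_div]; exact hσ2.le
  refine cruxTailT_of_conclOn fun t ht hT => ?_
  refine SourceContraction.conclOn_of_tendsto_defect fun γ C φ hγ hγ' hadm δ hδ => ?_
  -- STUB 3 at rate `Cd + 1`: the cell kernel, the kinetic window and the equilibrium bound
  obtain ⟨ψ, ℓ, Δ, hcell, hwin, HLD⟩ := H3 σ hσ hσ₃' γ C φ hγ hγ' hadm
  -- transfer to the local Gibbs law, uniformly in the window end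
  have hsmall : ∀ (a lam Cw : ℝ), 0 < a → 0 < lam → 0 < Cw → ∃ ε : ℝ, 0 < ε ∧ ∀ η : ℝ, 0 < η →
      ∀ᶠ N : ℕ in atTop, ∀ t' : ℝ, Δ N ≤ t' →
        localGibbsLaw σ a₀ u₀ θ₀ N (Φ N) (susEvent σ N (Φ N) φ ψ (Δ N) a ε lam Cw t') ≤ ENNReal.ofReal η := by
    intro a lam Cw ha' hlam hCw
    obtain ⟨ε, hε, Hc⟩ := HLD Φ a lam Cw ha' hlam hCw
    exact ⟨ε, hε, fun η hη =>
      transfer_rate (E := fun N t' => susEvent σ N (Φ N) φ ψ (Δ N) a ε lam Cw t')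
        (fun N A => hdom σ hσhalf N (Φ N) A) Hc hη⟩
  -- the three limits and the squeeze
  have hsplit := H1 σ hσ hσ2 a₀ θ₀ u₀ Φ γ C φ hγ hγ' hadm ψ ℓ hcell t ht δ hδ
  have hR := H2 σ hσ hσ₂' Φ hDiff γ C φ hγ hγ' hadm ψ ℓ hcell t ht hT (K⁻¹ * δ) (by positivity)
  have hCell := h4 a₀ θ₀ u₀ hnice σ hσ hσ2 Φ hDiff γ C φ hγ hγ' hadm ψ ℓ hcell Δ hwin t ht hT hsmall
    (K⁻¹ * δ) (by positivity)
  have hsum := hCell.add hR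
  rw [add_zero] at hsum
  exact tendsto_of_tendsto_of_tendsto_of_le_of_le' tendsto_const_nhds hsum
    (Eventually.of_forall fun N => bot_le) hsplit

/-- **THE LINE'S CERTIFICATE** (registered anchor `sa_composition_anchor`): the crux `CollisionIsometryCLT.AdaptedWeightCLT` follows BY
NAME from the two named residues `ReynoldsStub` (declared exposure) and `SuperExpCoreRateStub` (open dynamical core, prescribed-rate
form); every other ingredient of the line is landed. CONDITIONAL — it closes nothing by itself. -/
theorem adaptedWeightCLT_of_residues : ReynoldsStub → SuperExpCoreRateStub →
    Summit.AtomisticToContinuum.HydrodynamicLimit.Theses.CollisionIsometryCLT.AdaptedWeightCLT :=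
  fun h2 hcore => AdaptedWeightCLT_of_rate scaleSplitStub_holds h2 (superExpRateStub_of_coreRateStub hcore) windowStub_holds

/-- The same from the planner's `∀ c`-form of the core. -/
theorem adaptedWeightCLT_of_residues' : ReynoldsStub → SuperExpCoreStub →
    Summit.AtomisticToContinuum.HydrodynamicLimit.Theses.CollisionIsometryCLT.AdaptedWeightCLT :=
  fun h2 hcore => adaptedWeightCLT_of_residues h2 (superExpCoreRateStub_of_coreStub hcore)

/-- Registered anchor of this file (`sa_composition_anchor`): the certificate `adaptedWeightCLT_of_residues`. -/
theorem sa_composition_anchor : ReynoldsStub → SuperExpCoreRateStub →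
    Summit.AtomisticToContinuum.HydrodynamicLimit.Theses.CollisionIsometryCLT.AdaptedWeightCLT :=
  adaptedWeightCLT_of_residues

end

end Summit.AtomisticToContinuum.HydrodynamicLimit.Theorems.SustainedAnisotropy
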